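import Summits.Ventures.PercRepro.ProfilePointedGirth

/-!
# PercRepro — CONJECTURE (D): THEOREM A FOR THE `p`-AVOIDING PROFILE; IT IS A POINTED REFINEMENT OF THEOREM A (THE SUM
OVER THE POINTS IS EXACTLY THEOREM A) AND IT GIVES (Ĉ) IN THE `p`-GIRTH REGIME (p10, gen 25)

For a finite matroid `M` on `N = #E` elements and a point `p`, `out_k` (`outCount M k p`) is the number of bi-independent
`k`-sets avoiding `p` — the mixed profile `#{X ⊆ E ∖ p : X ∈ I(M ∖ p), (E ∖ p) ∖ X ∈ I(M / p)}` of the elementary quotient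
pair `M / p ≤ M ∖ p`.  THIS FILE records

* `AvoidRow` / `AvoidRowAt` — **CONJECTURE (D)** (a `Prop`, NOT asserted): `(N − k − 1)·out_k ≤ (k + 1)·out_{k+1}` for
  `2k + 2 ≤ N` — Theorem A's monotonicity on `N − 1` elements for the `p`-avoiding profile.  DATA: 0 violations on every
  `(M, p, k)` of the ≤ 8 catalogue (53,272 at `n = 8`), on the cell's refutation families (`M(K_{2,m})` + the binary point
  `h₁ + g₂`, `Θ_t` + chord, each ⊕ up to 300 coloops), on random binary / graphic / sparse paving matroids on 9 … 12 elements.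
* `sum_outCount_eq` — `Σ_{p ∈ E} out_k(p) = (N − k)·P_k`, hence `thmA_of_avoidRowAt`: **the sum of (D) over the points of
  `E` is EXACTLY Theorem A's monotonicity `(N − k)·P_k ≤ (k + 1)·P_{k+1}`** (the identity
  `Σ_p [(k+1)·out_{k+1}(p) − (N−k−1)·out_k(p)] = (N−k−1)·[(k+1)·P_{k+1} − (N−k)·P_k]`): (D) is a pointed refinement of the
  named fact, and no proof of (D) can be more elementary than one of Theorem A.
* `insert_mem_biIndepSets_of_indep_succ_mem`, `extCount_eq_outCount_of_indep_succ_mem`, `inCount_mul_le_of_indep_succ_mem`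
  — the `p`-GIRTH regime (every `(k+1)`-subset THROUGH `p` independent): every bi-independent `k`-set through `p` extends by
  every outside element, `c^p_k = out_k`, and `(N − k)·in_k ≤ k·in_{k+1}`;
* `pointedRow_level_of_avoidRow_of_indep_succ_mem` — **(D) at `(M, p, k)` gives (Ĉ) at `(M, p, k)` whenever every `(k+1)`-subset
  through `p` is independent** (unconditional implication), and `pointedRowAt_of_avoidRowAt_of_indep_half_mem`.

Nothing here asserts (D) or (Ĉ).
-/

open scoped Matroid

namespace PercRepro.Cogirth

open Finset ThmH Skew

variable {α : Type} [DecidableEq α] {M : Matroid α} [M.Finite]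

/-! ### Conjecture (D) -/

/-- **CONJECTURE (D) (NOT asserted)**: for every finite matroid on `α`, every point `p` and every level `k` with
`2k + 2 ≤ #E`, `(N − k − 1)·out_k ≤ (k + 1)·out_{k+1}`. -/
def AvoidRow (α : Type) [DecidableEq α] : Prop :=
  ∀ (M : Matroid α) [M.Finite] (p : α) (k : ℕ), p ∈ gr M → 2 * k + 2 ≤ (gr M).card →
    ((gr M).card - k - 1) * outCount M k p ≤ (k + 1) * outCount M (k + 1) p

/-- (D) at every level of one pointed matroid. -/
def AvoidRowAt (M : Matroid α) [M.Finite] (p : α) : Prop :=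
  ∀ k : ℕ, 2 * k + 2 ≤ (gr M).card → ((gr M).card - k - 1) * outCount M k p ≤ (k + 1) * outCount M (k + 1) p

/-! ### The sum over the points is Theorem A -/

/-- `Σ_{p ∈ E} out_k(p) = (N − k)·P_k`: every bi-independent `k`-set avoids exactly `N − k` points. -/
theorem sum_outCount_eq (M : Matroid α) [M.Finite] (k : ℕ) :
    ∑ p ∈ gr M, outCount M k p = ((gr M).card - k) * (biIndepSets M k).card := by
  unfold outCount
  simp_rw [card_filter]
  rw [sum_comm]
  rw [mul_comm, card_eq_sum_ones, sum_mul, one_mul]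
  apply sum_congr rfl
  intro X hX
  rw [← card_filter, ← sdiff_eq_filter, card_sdiff_of_subset (mem_biIndepSets.1 hX).1, (mem_biIndepSets.1 hX).2.1]

/-- **THE SUM OF (D) OVER THE POINTS IS THEOREM A**: if (D) holds at level `k` for every point of `M`, then
`(N − k)·P_k ≤ (k + 1)·P_{k+1}`. -/
theorem thmA_of_avoidRowAt (k : ℕ) (hk : 2 * k + 2 ≤ (gr M).card)
    (h : ∀ p ∈ gr M, ((gr M).card - k - 1) * outCount M k p ≤ (k + 1) * outCount M (k + 1) p) :
    ((gr M).card - k) * (biIndepSets M k).card ≤ (k + 1) * (biIndepSets M (k + 1)).card := by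
  have h1 : ∑ p ∈ gr M, ((gr M).card - k - 1) * outCount M k p ≤
      ∑ p ∈ gr M, (k + 1) * outCount M (k + 1) p := sum_le_sum h
  rw [← mul_sum, ← mul_sum, sum_outCount_eq, sum_outCount_eq] at h1
  -- h1 : (N-k-1) * ((N-k) * P_k) ≤ (k+1) * ((N-k-1) * P_{k+1})
  have hpos : 0 < (gr M).card - k - 1 := by omega
  apply Nat.le_of_mul_le_mul_left (c := (gr M).card - k - 1) _ hpos
  calc ((gr M).card - k - 1) * (((gr M).card - k) * (biIndepSets M k).card)
      ≤ (k + 1) * (((gr M).card - k - 1) * (biIndepSets M (k + 1)).card) := h1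
    _ = ((gr M).card - k - 1) * ((k + 1) * (biIndepSets M (k + 1)).card) := by ring

/-! ### The `p`-girth regime -/

/-- If every `(k+1)`-subset through `p` is independent, a bi-independent `k`-set through `p` extends by every outside
element. -/
theorem insert_mem_biIndepSets_of_indep_succ_mem {k : ℕ} {p : α}
    (h1 : ∀ X ⊆ gr M, p ∈ X → X.card = k + 1 → rk M X = X.card)
    {X : Finset α} (hX : X ∈ biIndepSets M k) (hpX : p ∈ X) {e : α} (he : e ∈ gr M) (heX : e ∉ X) :
    insert e X ∈ biIndepSets M (k + 1) := by
  rw [mem_biIndepSets] at hX ⊢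
  obtain ⟨hXg, hXc, -, hXd⟩ := hX
  have hsub : insert e X ⊆ gr M := insert_subset he hXg
  have hcard : (insert e X).card = k + 1 := by rw [card_insert_of_notMem heX, hXc]
  refine ⟨hsub, hcard, h1 _ hsub (mem_insert_of_mem hpX) hcard, ?_⟩
  exact rk_eq_card_of_subset_of_rk_eq_card (sdiff_subset_sdiff (subset_refl _) (subset_insert e X)) hXd

/-- In the `p`-girth regime `c^p_k = out_k`: every `p`-avoiding bi-independent `k`-set extends by `p`. -/
theorem extCount_eq_outCount_of_indep_succ_mem {k : ℕ} {p : α} (hp : p ∈ gr M)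
    (h1 : ∀ X ⊆ gr M, p ∈ X → X.card = k + 1 → rk M X = X.card) :
    extCount M k p = outCount M k p := by
  unfold extCount outCount
  congr 1
  apply filter_congr
  intro X hX
  refine ⟨fun h => h.1, fun hpX => ⟨hpX, ?_⟩⟩
  rw [mem_biIndepSets] at hX ⊢
  obtain ⟨hXg, hXc, -, hXd⟩ := hX
  have hsub : insert p X ⊆ gr M := insert_subset hp hXg
  have hcard : (insert p X).card = k + 1 := by rw [card_insert_of_notMem hpX, hXc]
  refine ⟨hsub, hcard, h1 _ hsub (mem_insert_self p X) hcard, ?_⟩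
  exact rk_eq_card_of_subset_of_rk_eq_card (sdiff_subset_sdiff (subset_refl _) (subset_insert p X)) hXd

/-- **`(N − k)·in_k ≤ k·in_{k+1}`** in the `p`-girth regime (the double count of ProfilePointedGirth on the sets through `p`). -/
theorem inCount_mul_le_of_indep_succ_mem {k : ℕ} {p : α}
    (h1 : ∀ X ⊆ gr M, p ∈ X → X.card = k + 1 → rk M X = X.card) :
    inCount M k p * ((gr M).card - k) ≤ inCount M (k + 1) p * k := by
  unfold inCount
  apply card_mul_le_card_mul (· ⊆ ·)
  · intro X hX
    rw [mem_filter] at hX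
    apply le_card_bipartiteAbove_of_indep_succ hX.1
    intro e he heX
    rw [mem_filter]
    exact ⟨insert_mem_biIndepSets_of_indep_succ_mem h1 hX.1 hX.2 he heX, mem_insert_of_mem hX.2⟩
  · intro X' hX'
    rw [mem_filter] at hX'
    exact card_bipartiteBelow_in_le hX'.1

/-- **(D) GIVES (Ĉ) IN THE `p`-GIRTH REGIME** (unconditional implication): if every `(k+1)`-subset through `p` is
independent, `2k + 2 ≤ N` and `(N − k − 1)·out_k ≤ (k + 1)·out_{k+1}`, then (Ĉ) holds at `(M, p, k)`. -/
theorem pointedRow_level_of_avoidRow_of_indep_succ_mem {k : ℕ} (hk : 2 * k + 2 ≤ (gr M).card) {p : α} (hp : p ∈ gr M)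
    (h1 : ∀ X ⊆ gr M, p ∈ X → X.card = k + 1 → rk M X = X.card)
    (hD : ((gr M).card - k - 1) * outCount M k p ≤ (k + 1) * outCount M (k + 1) p) :
    ((gr M).card - k - 1) * (biIndepSets M k).card ≤
      k * (biIndepSets M (k + 1)).card + ((gr M).card - 2 * k - 1) * extCount M k p := by
  rw [extCount_eq_outCount_of_indep_succ_mem hp h1, ← inCount_add_outCount M k p, ← inCount_add_outCount M (k + 1) p]
  have hI := inCount_mul_le_of_indep_succ_mem (M := M) (p := p) h1
  obtain ⟨m, hm⟩ := Nat.exists_eq_add_of_le hk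
  rw [hm] at hI hD ⊢
  rw [show 2 * k + 2 + m - k = k + 2 + m by omega] at hI
  rw [show 2 * k + 2 + m - k - 1 = k + 1 + m by omega] at hD ⊢
  rw [show 2 * k + 2 + m - 2 * k - 1 = m + 1 by omega]
  generalize inCount M k p = a at hI hD ⊢
  generalize outCount M k p = b at hI hD ⊢
  generalize inCount M (k + 1) p = a' at hI hD ⊢
  generalize outCount M (k + 1) p = b' at hI hD ⊢
  -- goal: (k+1+m)(a+b) ≤ k(a'+b') + (m+1) b, from a(k+2+m) ≤ a'k and (k+1+m) b ≤ (k+1) b'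
  have hb : b ≤ b' := by
    apply Nat.le_of_mul_le_mul_left (c := k + 1 + m) _ (by omega)
    calc (k + 1 + m) * b ≤ (k + 1) * b' := hD
      _ ≤ (k + 1 + m) * b' := Nat.mul_le_mul_right _ (by omega)
  apply Nat.le_of_mul_le_mul_left (c := k + 2 + m) _ (by omega)
  have hI' := Nat.mul_le_mul_left (k + 1 + m) hI
  have ha2 : (k + 1 + m) * (a' * k) ≤ (k + 2 + m) * (a' * k) := Nat.mul_le_mul_right _ (by omega)
  have hb2 : (k + 2 + m) * k * b ≤ (k + 2 + m) * k * b' := Nat.mul_le_mul_left _ hb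
  nlinarith [hI', ha2, hb2, Nat.zero_le b, Nat.zero_le k, Nat.zero_le m]

/-- (D) at `(M, p)` gives (Ĉ) at every level of `(M, p)` whenever every subset through `p` with at most `N/2` elements is
independent (the `p`-girth exceeds `N/2`). -/
theorem pointedRowAt_of_avoidRowAt_of_indep_half_mem {p : α} (hp : p ∈ gr M) (hD : AvoidRowAt M p)
    (h : ∀ X ⊆ gr M, p ∈ X → 2 * X.card ≤ (gr M).card → rk M X = X.card) : PointedRowAt M p := by
  intro k hk
  exact pointedRow_level_of_avoidRow_of_indep_succ_mem hk hp (fun X hX hpX hXc => h X hX hpX (by omega)) (hD k hk)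

end PercRepro.Cogirth
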